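import Mathlib
import Literature.NumberTheory.LFunctions.Zhang2022.Section4Lemma44Chain
import Literature.NumberTheory.LFunctions.Zhang2022.Section4PartialIntegration
import HarnessLib

/-!
# Zhang (2022) §4, Lemma 4.4: the manuscript's proof chain, II — (4.8): the second deduction
# `Line48Bound → MidSumPI → Eq48` and the partial-integration bound for the middle sum, PROVED

Topic `Literature/NumberTheory/LFunctions/Zhang2022` (Landau–Siegel adjudication tree;
verdict-neutral). Y. Zhang, *Discrete mean estimates and the Landau–Siegel zero*,
arXiv:2211.02515v1 (2022) [Zhang2022LandauSiegel] — **an unrefereed manuscript under adjudication**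
— §4, proof of (4.8) (PDF p. 20, tex L1096–L1113):

> To prove (4.8) we move the contour of integration to the vertical segments […]. By a trivial
> bound for `ω₁(w)` and (4.5) we see that the left side of (4.8) is
> `≪ P^{1−2σ}∫_{−𝓛²⁰}^{𝓛²⁰}|Σ_{D⁴<n≤P²} ν(n)ψ(n)n^{−(s*+iv)}| dv/(α+iv) + ε` with `s* = 1 + α − s̄`.
> By partial integration, `Σ_{D⁴<n≤P²} ν(n)ψ(n)n^{−(s*+iv)} = ∫_{D⁴}^{P²} x^{s₀−s*−iv}dX₃(x,ψ)
> ≪ P^{2σ−1}𝓛₁(|X₃(P²,ψ)| + ∫_{D⁴}^{P²}|X₃(x,ψ)|x⁻¹dx)` for `|v| ≤ 𝓛²⁰`. From this and (3.5) we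
> obtain (4.8).

Against the typed statements of `Section4Statements.lean` (L1-t3: `Line48Bound`, `MidSumPI`,
`Eq48`, `Ded48b := Line48Bound → MidSumPI → Eq48`) this file PROVES (theorems only; no definition,
no new named fact; DAG node ids of `plan/DAG.tsv` in each docstring):

* `Section4.ded48b_holds : Ded48b` — **`Z22:(4.8)`**, second deduction ("From this and (3.5) we
  obtain (4.8)"): with the kernel `∫_{−𝓛²⁰}^{𝓛²⁰} dv/|α+iv| = 2arsinh(𝓛²⁹/π) ≤ 60𝓛` computed
  (`integral_inv_sqrt_sq_add_sq`, `integral_norm_div_le`, `two_arsinh_le`), `P^{1−2σ}P^{2σ−1} = 1`,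
  `𝓛₁𝓛⁻⁵⁸⁵·60𝓛 = 60𝓛⁻¹⁷⁹` and `ε ≤ 𝓛⁻¹⁷⁹` eventually;
* `Section4.midSumPI_holds : MidSumPI` — **`Z22:§4.u035`** FULLY DISCHARGED (unconditional: every
  `ψ ∈ Ψ`, `s ∈ Ω₃`, `|v| ≤ 𝓛²⁰`; constant `2e^{2π}`): Abel summation in the tree's form
  `Lemma41.norm_sum_mul_cpow_le` (`Section4PartialIntegration`) with `c(n) = ν(n)ψ(n)n^{−s₀}`,
  `z = s₀ − s* − iv` (`Re z = σ − ½ − α`, so `x^{Re z} ≤ e^{2π}P^{2σ−1}` on `[D⁴, P²]` since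
  `P^{2α} = e^{2π}`; `|z| ≤ 1 + 𝓛₁ + 3 + 𝓛²⁰ ≤ 2𝓛₁`), and `Lemma41.Xsum = Skeleton.X3`.

What is NOT proved here: the majorant `Line48Bound` itself (contour shift + (4.5) + "trivial bound
for `ω₁`"), hence (4.8) as such; nothing about Theorems 1–2 of the source or about Landau–Siegel
zeros is stated or implied.

## References

* Y. Zhang, arXiv:2211.02515v1 (2022), §4 (4.8) and its proof, p. 20; (3.5) p. 15; (2.6)–(2.8),
  (2.10). [cite: Zhang2022LandauSiegel, §4 (4.8) (proof) p. 20]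
* Mathlib, `Mathlib/NumberTheory/AbelSummation.lean`; `Real.arsinh`
  (`Mathlib/Analysis/SpecialFunctions/Arsinh.lean`).
-/

noncomputable section

open Complex Real ComplexConjugate MeasureTheory

namespace Literature.NumberTheory.LFunctions.Zhang2022.Section4

open Skeleton

/-! ### The kernel `∫_{−V}^{V} dv/|α+iv| = 2·arsinh(V/α)` of the (4.8) majorant -/

/-- `|a + iv| = √(a² + v²)`. [folklore] -/
private theorem norm_ofReal_add_mul_I (a v : ℝ) : ‖(a : ℂ) + v * I‖ = Real.sqrt (a ^ 2 + v ^ 2) := by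
  rw [Complex.norm_eq_sqrt_sq_add_sq]; simp

/-- `d/dv arsinh(v/a) = 1/√(a²+v²)` for `a > 0`. [folklore] -/
private theorem hasDerivAt_arsinh_div {a : ℝ} (ha : 0 < a) (v : ℝ) :
    HasDerivAt (fun v : ℝ => Real.arsinh (v / a)) (Real.sqrt (a ^ 2 + v ^ 2))⁻¹ v := by
  have h := (Real.hasDerivAt_arsinh (v / a)).comp v ((hasDerivAt_id v).div_const a)
  have h1 : a * Real.sqrt (1 + (v / a) ^ 2) = Real.sqrt (a ^ 2 + v ^ 2) := by
    have e : a ^ 2 + v ^ 2 = a ^ 2 * (1 + (v / a) ^ 2) := by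
      field_simp
    rw [e, Real.sqrt_mul (sq_nonneg a), Real.sqrt_sq ha.le]
  have h2 : (Real.sqrt (1 + (v / a) ^ 2))⁻¹ * (1 / a) = (Real.sqrt (a ^ 2 + v ^ 2))⁻¹ := by
    rw [← h1, mul_inv]; ring
  rw [← h2]
  exact h

/-- `∫_{−V}^{V} dv/√(a²+v²) = 2 arsinh(V/a)` for `a > 0` (the kernel `∫dv/|α+iv|` of the (4.8)
majorant, evaluated). [cite: Zhang2022LandauSiegel, §4 (4.8) (proof) p. 20] -/
theorem integral_inv_sqrt_sq_add_sq {a : ℝ} (ha : 0 < a) (V : ℝ) :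
    ∫ v in (-V)..V, (Real.sqrt (a ^ 2 + v ^ 2))⁻¹ = 2 * Real.arsinh (V / a) := by
  have hcont : Continuous fun v : ℝ => (Real.sqrt (a ^ 2 + v ^ 2))⁻¹ := by
    refine Continuous.inv₀ (by fun_prop) fun v => ?_
    exact (Real.sqrt_pos.mpr (by positivity)).ne'
  rw [intervalIntegral.integral_eq_sub_of_hasDerivAt (fun v _ => hasDerivAt_arsinh_div ha v)
    (hcont.intervalIntegrable _ _)]
  rw [neg_div, Real.arsinh_neg]; ring

/-- The majorant step of (4.8): if `|S(v)| ≤ K` for `|v| ≤ V` then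
`∫_{−V}^{V} |S(v)|/|a+iv| dv ≤ K · 2arsinh(V/a)` (`a > 0`). [cite: Zhang2022LandauSiegel, §4 (4.8) (proof) p. 20] -/
theorem integral_norm_div_le {V a K : ℝ} (ha : 0 < a) (hV : 0 ≤ V) (S : ℝ → ℂ)
    (hS : ∀ v : ℝ, |v| ≤ V → ‖S v‖ ≤ K) :
    ∫ v in (-V)..V, ‖S v‖ / ‖(a : ℂ) + v * I‖ ≤ K * (2 * Real.arsinh (V / a)) := by
  have hcont : Continuous fun v : ℝ => (Real.sqrt (a ^ 2 + v ^ 2))⁻¹ := by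
    refine Continuous.inv₀ (by fun_prop) fun v => ?_
    exact (Real.sqrt_pos.mpr (by positivity)).ne'
  have hVV : -V ≤ V := by linarith
  rw [← integral_inv_sqrt_sq_add_sq ha V, ← intervalIntegral.integral_const_mul,
    intervalIntegral.integral_of_le hVV, intervalIntegral.integral_of_le hVV]
  refine MeasureTheory.integral_mono_of_nonneg ?_ ?_ ?_
  · exact Filter.Eventually.of_forall fun v => div_nonneg (norm_nonneg _) (norm_nonneg _)
  · exact ((continuous_const.mul hcont).integrableOn_Icc).mono_set Set.Ioc_subset_Icc_self
  · refine MeasureTheory.ae_restrict_of_forall_mem measurableSet_Ioc fun v hv => ?_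
    have hv' : |v| ≤ V := abs_le.mpr ⟨hv.1.le, hv.2⟩
    show ‖S v‖ / ‖(a : ℂ) + v * I‖ ≤ K * (Real.sqrt (a ^ 2 + v ^ 2))⁻¹
    rw [norm_ofReal_add_mul_I, div_eq_mul_inv]
    exact mul_le_mul_of_nonneg_right (hS v hv') (inv_nonneg.mpr (Real.sqrt_nonneg _))

/-- `2·arsinh(𝓛²⁹/π) ≤ 60𝓛` for `𝓛 ≥ 1` ("`∫_{−𝓛²⁰}^{𝓛²⁰} dv/|α+iv| ≪ log 𝓛 ≪ 𝓛`", `α = π𝓛⁻⁹`).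
[cite: Zhang2022LandauSiegel, §4 (4.8) (proof) p. 20] -/
theorem two_arsinh_le {L : ℝ} (hL : 1 ≤ L) :
    2 * Real.arsinh (L ^ 20 / (Real.pi / L ^ 9)) ≤ 60 * L := by
  have hL0 : 0 < L := by linarith
  set y : ℝ := L ^ 20 / (Real.pi / L ^ 9) with hy
  have hy' : y = L ^ 29 / Real.pi := by
    rw [hy, div_div_eq_mul_div]; ring
  have hy0 : 0 ≤ y := by rw [hy']; positivity
  have hL29 : 1 ≤ L ^ 29 := one_le_pow₀ hL
  -- `arsinh y = log (y + √(1+y²)) ≤ log (1 + 2y) ≤ log (2 L²⁹)`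
  have hsq : Real.sqrt (1 + y ^ 2) ≤ 1 + y := by
    calc Real.sqrt (1 + y ^ 2) ≤ Real.sqrt ((1 + y) ^ 2) :=
          Real.sqrt_le_sqrt (by nlinarith)
      _ = 1 + y := Real.sqrt_sq (by linarith)
  have h2y : y + Real.sqrt (1 + y ^ 2) ≤ 2 * L ^ 29 := by
    have : 2 * y ≤ L ^ 29 := by
      rw [hy', mul_div_assoc', div_le_iff₀ Real.pi_pos]
      nlinarith [Real.two_le_pi]
    linarith
  have hpos : 0 < y + Real.sqrt (1 + y ^ 2) := by
    have : 0 < Real.sqrt (1 + y ^ 2) := Real.sqrt_pos.mpr (by positivity)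
    linarith
  have harsinh : Real.arsinh y ≤ Real.log (2 * L ^ 29) := by
    rw [Real.arsinh]
    exact Real.log_le_log hpos h2y
  have hlog : Real.log (2 * L ^ 29) ≤ 30 * L := by
    rw [Real.log_mul (by norm_num) (by positivity), Real.log_pow]
    have h2 : Real.log 2 ≤ 1 := le_trans Real.log_two_lt_d9.le (by norm_num)
    have hlogL : Real.log L ≤ L := (Real.log_le_sub_one_of_pos hL0).trans (by linarith)
    push_cast
    nlinarith
  linarith

/-! ### Z22:(4.8), second deduction: `Line48Bound → MidSumPI → Eq48` -/

/-- `D⁴ ≤ P²` once `𝓛 ≥ 2` (`D⁴ = e^{4𝓛}`, `P² = e^{2𝓛⁹}`). [cite: Zhang2022LandauSiegel, §2 (2.6)] -/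
theorem pow_four_le_bigP_sq {D : ℕ} (hℓ2 : 2 ≤ ell D) : (D : ℝ) ^ 4 ≤ bigP D ^ 2 := by
  have hℓ : 0 < ell D := by linarith
  have hD0 : (0 : ℝ) < D := by
    have hD : D ≠ 0 := by
      rintro rfl
      simp [ell] at hℓ2; linarith
    exact_mod_cast Nat.pos_of_ne_zero hD
  have hD' : (D : ℝ) = Real.exp (ell D) := by rw [ell, Real.exp_log hD0]
  have h8 : (2 : ℝ) ^ 8 ≤ ell D ^ 8 := pow_le_pow_left₀ (by norm_num) hℓ2 8
  have hexp : (4 : ℕ) * ell D ≤ (2 : ℕ) * ell D ^ 9 := by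
    push_cast
    calc 4 * ell D ≤ 2 * (ell D * ell D ^ 8) := by nlinarith [h8, hℓ.le]
      _ = 2 * ell D ^ 9 := by ring
  rw [hD', bigP, ← Real.exp_nat_mul, ← Real.exp_nat_mul]
  exact Real.exp_le_exp.mpr hexp

/-- The (3.5)-bracket `|X₃(P²,ψ)| + ∫_{D⁴}^{P²}|X₃(x,ψ)|x⁻¹dx` is nonnegative once `D⁴ ≤ P²`
(`𝓛 ≥ 2`). [cite: Zhang2022LandauSiegel, §3 (3.5)] -/
theorem bracket35_nonneg {D : ℕ} [NeZero D] (χ : DirichletCharacter ℂ D) (x : Chr D)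
    (hℓ2 : 2 ≤ ell D) :
    0 ≤ ‖X3 χ x (bigP D ^ 2)‖ + ∫ y in (D : ℝ) ^ 4..bigP D ^ 2, ‖X3 χ x y‖ / y := by
  have hint : 0 ≤ ∫ y in (D : ℝ) ^ 4..bigP D ^ 2, ‖X3 χ x y‖ / y := by
    refine intervalIntegral.integral_nonneg (pow_four_le_bigP_sq hℓ2) fun y hy => ?_
    exact div_nonneg (norm_nonneg _) (le_trans (by positivity) hy.1)
  exact add_nonneg (norm_nonneg _) hint

/-- **"From this and (3.5) we obtain (4.8)" is a valid deduction** (DAG `Z22:(4.8)` second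
deduction, [Z22 p. 20, tex L1107–L1113]): the typed node `Section4.Ded48b` HOLDS — from the majorant
`Line48Bound` ("`≪ P^{1−2σ}∫_{−𝓛²⁰}^{𝓛²⁰}|Σ_{D⁴<n≤P²}ν(n)ψ(n)n^{−(s*+iv)}| dv/|α+iv| + ε`"), the
partial-integration bound `MidSumPI` ("`≪ P^{2σ−1}𝓛₁(|X₃(P²,ψ)| + ∫|X₃|x⁻¹dx)`") and (3.5) for
`ψ ∈ Ψ₁` (`Skeleton.Ineq35`), the (4.8) bound `≪ 𝓛⁻¹⁷⁹` follows: `P^{1−2σ}P^{2σ−1} = 1`,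
`∫_{−𝓛²⁰}^{𝓛²⁰} dv/|α+iv| = 2arsinh(𝓛²⁹/π) ≤ 60𝓛` (kernel-proved), `𝓛₁𝓛⁻⁵⁸⁵·60𝓛 = 60𝓛⁻¹⁷⁹`, and
`ε = e^{−c𝓛¹⁰} ≤ 𝓛⁻¹⁷⁹` eventually. Kernel-checked; the two inputs stay CLAIMS.
[cite: Zhang2022LandauSiegel, §4 (4.8) (proof) p. 20] -/
theorem ded48b_holds : Ded48b := by
  intro hL hM
  obtain ⟨c, hc, CL, hL⟩ := hL
  obtain ⟨CM, hM⟩ := hM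
  obtain ⟨D₀, hall⟩ := hL.and hM
  set L₀ : ℝ := max 2 ((179 : ℕ) / c) with hL₀
  refine ⟨max CL 0 * (max CM 0 * 60 + 1), max D₀ ⌈Real.exp L₀⌉₊,
    fun D _ χ hD hq hp x hx s hs => ?_⟩
  obtain ⟨hL', hM'⟩ := hall D χ (le_trans (le_max_left _ _) hD) hq hp
  have hL₀D : L₀ ≤ ell D := le_ell_of_ceil_exp_le (le_trans (le_max_right _ _) hD)
  have hℓ2 : 2 ≤ ell D := le_trans (le_max_left _ _) hL₀D
  have hℓ1 : 1 ≤ ell D := le_trans one_le_two hℓ2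
  have hℓ : 0 < ell D := lt_of_lt_of_le zero_lt_one hℓ1
  have hcD : ((179 : ℕ) : ℝ) / c ≤ ell D := le_trans (le_max_right _ _) hL₀D
  have hP : 0 < bigP D := Real.exp_pos _
  have hα : alpha D = Real.pi / ell D ^ 9 := by rw [alpha, bigP, Real.log_exp]
  have hα0 : 0 < alpha D := by rw [hα]; positivity
  -- the (3.5) bracket
  set B : ℝ := ‖X3 χ x (bigP D ^ 2)‖ + ∫ y in (D : ℝ) ^ 4..bigP D ^ 2, ‖X3 χ x y‖ / y with hB
  have hB0 : 0 ≤ B := bracket35_nonneg χ x hℓ2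
  have h35 : B < (ell D ^ 585)⁻¹ := hx.2.1
  -- the uniform bound on the middle sum for `|v| ≤ 𝓛²⁰`
  set K₁ : ℝ := max CM 0 * bigP D ^ (2 * s.re - 1) * ell1 D * B with hK₁
  have hℓ1' : 0 ≤ ell1 D := by rw [ell1]; positivity
  have hPσ : 0 ≤ bigP D ^ (2 * s.re - 1) := (Real.rpow_pos_of_pos hP _).le
  have hK₁0 : 0 ≤ K₁ := by positivity
  have hSv : ∀ v : ℝ, |v| ≤ ell D ^ 20 →
      ‖∑ n ∈ Finset.Ioc (D ^ 4) ⌊bigP D ^ 2⌋₊,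
          nu χ n * x.ψ (n : ZMod x.p) * (n : ℂ) ^ (-(sStar D s + v * I))‖ ≤ K₁ := by
    intro v hv
    refine le_trans (hM' x s hs v hv) ?_
    have h0 : 0 ≤ bigP D ^ (2 * s.re - 1) * ell1 D * B := by positivity
    calc CM * bigP D ^ (2 * s.re - 1) * ell1 D * B
        = CM * (bigP D ^ (2 * s.re - 1) * ell1 D * B) := by ring
      _ ≤ max CM 0 * (bigP D ^ (2 * s.re - 1) * ell1 D * B) :=
          mul_le_mul_of_nonneg_right (le_max_left _ _) h0
      _ = K₁ := by rw [hK₁]; ring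
  -- the integral majorant
  have hI := integral_norm_div_le hα0 (by positivity : (0 : ℝ) ≤ ell D ^ 20)
    (fun v : ℝ => ∑ n ∈ Finset.Ioc (D ^ 4) ⌊bigP D ^ 2⌋₊,
      nu χ n * x.ψ (n : ZMod x.p) * (n : ℂ) ^ (-(sStar D s + v * I))) hSv
  have h60 : 2 * Real.arsinh (ell D ^ 20 / alpha D) ≤ 60 * ell D := by
    rw [hα]; exact two_arsinh_le hℓ1
  set Iv : ℝ := ∫ v in (-(ell D ^ 20))..(ell D ^ 20),
      ‖∑ n ∈ Finset.Ioc (D ^ 4) ⌊bigP D ^ 2⌋₊,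
          nu χ n * x.ψ (n : ZMod x.p) * (n : ℂ) ^ (-(sStar D s + v * I))‖
        / ‖(alpha D : ℂ) + v * I‖ with hIv
  have hIv_le : Iv ≤ K₁ * (60 * ell D) :=
    le_trans hI (mul_le_mul_of_nonneg_left h60 hK₁0)
  have hIv0 : 0 ≤ Iv := by
    rw [hIv]
    refine intervalIntegral.integral_nonneg (by linarith [pow_nonneg hℓ.le 20]) fun v _ => ?_
    exact div_nonneg (norm_nonneg _) (norm_nonneg _)
  -- `P^{1−2σ}·P^{2σ−1} = 1`
  have hPP : bigP D ^ (1 - 2 * s.re) * bigP D ^ (2 * s.re - 1) = 1 := by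
    rw [← Real.rpow_add hP]; norm_num
  have hP1 : 0 ≤ bigP D ^ (1 - 2 * s.re) := (Real.rpow_pos_of_pos hP _).le
  have hε : epsW c D ≤ (ell D ^ 179)⁻¹ := epsW_le_inv_pow hc 179 hℓ1 hcD
  have hε0 : 0 ≤ epsW c D := (Real.exp_pos _).le
  -- `𝓛₁ · B · 60𝓛 ≤ 60 𝓛⁻¹⁷⁹`
  have hmain : ell1 D * B * (60 * ell D) ≤ 60 * (ell D ^ 179)⁻¹ := by
    have h1 : ell1 D * B ≤ ell1 D * (ell D ^ 585)⁻¹ := mul_le_mul_of_nonneg_left h35.le hℓ1'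
    have h2 : ell1 D * (ell D ^ 585)⁻¹ * (60 * ell D) = 60 * (ell D ^ 179)⁻¹ := by
      rw [ell1]; field_simp
    calc ell1 D * B * (60 * ell D) ≤ ell1 D * (ell D ^ 585)⁻¹ * (60 * ell D) :=
          mul_le_mul_of_nonneg_right h1 (by positivity)
      _ = 60 * (ell D ^ 179)⁻¹ := h2
  calc ‖perronLine D (f48 χ x s) (-s.re - 1 / 2)‖
      ≤ CL * (bigP D ^ (1 - 2 * s.re) * Iv + epsW c D) := hL' x s hs
    _ ≤ max CL 0 * (bigP D ^ (1 - 2 * s.re) * Iv + epsW c D) :=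
        mul_le_mul_of_nonneg_right (le_max_left _ _) (by positivity)
    _ ≤ max CL 0 * (bigP D ^ (1 - 2 * s.re) * (K₁ * (60 * ell D)) + (ell D ^ 179)⁻¹) := by
        gcongr
    _ = max CL 0 * (max CM 0 * (bigP D ^ (1 - 2 * s.re) * bigP D ^ (2 * s.re - 1))
          * (ell1 D * B * (60 * ell D)) + (ell D ^ 179)⁻¹) := by
        rw [hK₁]; ring
    _ = max CL 0 * (max CM 0 * (ell1 D * B * (60 * ell D)) + (ell D ^ 179)⁻¹) := by
        rw [hPP, mul_one]
    _ ≤ max CL 0 * (max CM 0 * (60 * (ell D ^ 179)⁻¹) + (ell D ^ 179)⁻¹) := by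
        gcongr
    _ = max CL 0 * (max CM 0 * 60 + 1) * (ell D ^ 179)⁻¹ := by ring

/-! ### Z22:§4.u035: the partial-integration bound for the middle sum (FULL discharge) -/

/-- `⌊D⁴⌋₊ = D⁴` for the real number `(D:ℝ)⁴` (the lower endpoint of `X₃`'s range).
[cite: Zhang2022LandauSiegel, §3 p. 7 (X₃)] -/
theorem floor_natCast_pow_four (D : ℕ) : ⌊((D : ℝ) ^ 4)⌋₊ = D ^ 4 := by
  rw [← Nat.cast_pow, Nat.floor_natCast]

/-- The tree's partial sum `Lemma41.Xsum` of the normalised coefficients `ν(n)ψ(n)n^{−s₀}` from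
`D⁴` is the manuscript's `X₃(x,ψ)` (`Skeleton.X3`). [cite: Zhang2022LandauSiegel, §3 p. 7 (X₃)] -/
theorem Xsum_eq_X3 {D : ℕ} [NeZero D] (χ : DirichletCharacter ℂ D) (x : Chr D) (y : ℝ) :
    Lemma41.Xsum (fun n => nu χ n * x.ψ (n : ZMod x.p) * (n : ℂ) ^ (-s0 D)) ((D : ℝ) ^ 4) y
      = X3 χ x y := by
  rw [Lemma41.Xsum_eq_sum_Ioc, floor_natCast_pow_four, X3]

/-- **"By partial integration, `Σ_{D⁴<n≤P²} ν(n)ψ(n)n^{−(s*+iv)} = ∫_{D⁴}^{P²} x^{s₀−s*−iv}dX₃(x,ψ)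
≪ P^{2σ−1}𝓛₁(|X₃(P²,ψ)| + ∫_{D⁴}^{P²}|X₃(x,ψ)|x⁻¹dx)` for `|v| ≤ 𝓛²⁰`" HOLDS** (DAG `Z22:§4.u035`,
[Z22 p. 20, tex L1109–L1112]; node `Section4.MidSumPI`, for every `ψ ∈ Ψ` and `s ∈ Ω₃`), with the
constant `C = 2e^{2π}`: Abel summation in the tree's form `Lemma41.norm_sum_mul_cpow_le` with
`c(n) = ν(n)ψ(n)n^{−s₀}`, `z = s₀ − s* − iv` (`Re z = σ − ½ − α ∈ (−2α, ½)`, so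
`x^{Re z} ≤ e^{2π}P^{2σ−1}` on `[D⁴, P²]` as `P^{2α} = e^{2π}`; `|z| ≤ 1 + 𝓛₁ + 3 + 𝓛²⁰ ≤ 2𝓛₁`).
Kernel-checked, unconditional. [cite: Zhang2022LandauSiegel, §4 (4.8) (proof) p. 20] -/
theorem midSumPI_holds : MidSumPI := by
  refine ⟨2 * Real.exp (2 * Real.pi), ⌈Real.exp 2⌉₊, fun D _ χ hD hq hp x s hs v hv => ?_⟩
  have hℓ2 : 2 ≤ ell D := le_ell_of_ceil_exp_le hD
  have hℓ1 : 1 ≤ ell D := le_trans one_le_two hℓ2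
  have hℓ : 0 < ell D := lt_of_lt_of_le zero_lt_one hℓ1
  have hDne : D ≠ 0 := by
    rintro rfl
    simp [ell] at hℓ2; linarith
  have hD0 : (0 : ℝ) < D := by exact_mod_cast Nat.pos_of_ne_zero hDne
  have hP : 0 < bigP D := Real.exp_pos _
  have hP1 : 1 ≤ bigP D := by rw [bigP]; exact Real.one_le_exp (by positivity)
  have hα : alpha D = Real.pi / ell D ^ 9 := by rw [alpha, bigP, Real.log_exp]
  have hα0 : 0 < alpha D := by rw [hα]; positivity
  have hα4 : alpha D ≤ 1 / 4 := by
    rw [hα, div_le_div_iff₀ (by positivity) (by norm_num)]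
    have h9 : (2 : ℝ) ^ 9 ≤ ell D ^ 9 := pow_le_pow_left₀ (by norm_num) hℓ2 9
    nlinarith [Real.pi_lt_four]
  -- `Ω₃`: `1/2 − α < σ < 1 + α`, `|t − 2πt₀| < 𝓛₁ + 3`
  obtain ⟨hσ1, hσ2, ht⟩ := hs
  -- `D⁴ ≤ P²`, `0 < D⁴`
  have ha0 : (0 : ℝ) < (D : ℝ) ^ 4 := by positivity
  have hD4P2 : (D : ℝ) ^ 4 ≤ bigP D ^ 2 := pow_four_le_bigP_sq hℓ2
  -- the normalised coefficients and the exponent `z = s₀ − s* − iv`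
  set c : ℕ → ℂ := fun n => nu χ n * x.ψ (n : ZMod x.p) * (n : ℂ) ^ (-s0 D) with hc
  set z : ℂ := s0 D - sStar D s - v * I with hz
  have hzre : z.re = s.re - 1 / 2 - alpha D := by
    rw [hz, sStar, s0, SmoothWeight.s0_def]
    simp; ring
  have hzim : z.im = 2 * Real.pi * t0 D - s.im - v := by
    rw [hz, sStar, s0, SmoothWeight.s0_def]
    simp
  -- rewrite the sum in the tree's shape `Σ_{⌊a⌋<n≤⌊b⌋} c(n) n^z`
  have hsum : ∑ n ∈ Finset.Ioc (D ^ 4) ⌊bigP D ^ 2⌋₊,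
        nu χ n * x.ψ (n : ZMod x.p) * (n : ℂ) ^ (-(sStar D s + v * I))
      = ∑ n ∈ Finset.Ioc ⌊((D : ℝ) ^ 4)⌋₊ ⌊bigP D ^ 2⌋₊, c n * (n : ℂ) ^ z := by
    rw [floor_natCast_pow_four]
    refine Finset.sum_congr rfl fun n hn => ?_
    have hn0 : (n : ℂ) ≠ 0 := by
      have : 0 < n := lt_of_le_of_lt (Nat.zero_le _) (Finset.mem_Ioc.mp hn).1
      exact_mod_cast this.ne'
    rw [hc]
    simp only
    rw [mul_assoc (nu χ n * x.ψ (n : ZMod x.p)), ← Complex.cpow_add _ _ hn0]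
    congr 2
    rw [hz]; ring
  -- the supremum `x^{Re z} ≤ e^{2π} P^{2σ−1}` on `[D⁴, P²]`
  set M : ℝ := Real.exp (2 * Real.pi) * bigP D ^ (2 * s.re - 1) with hM
  have hP2α : bigP D ^ (-(2 * alpha D)) = Real.exp (-(2 * Real.pi)) := by
    rw [hα, bigP, ← Real.exp_mul]
    congr 1
    field_simp
  have hM1 : 1 ≤ M := by
    -- `P^{2σ−1} ≥ P^{−2α} = e^{−2π}`
    have h1 : bigP D ^ (-(2 * alpha D)) ≤ bigP D ^ (2 * s.re - 1) :=
      Real.rpow_le_rpow_of_exponent_le hP1 (by linarith)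
    rw [hP2α] at h1
    calc (1 : ℝ) = Real.exp (2 * Real.pi) * Real.exp (-(2 * Real.pi)) := by
          rw [← Real.exp_add]; simp
      _ ≤ M := mul_le_mul_of_nonneg_left h1 (Real.exp_pos _).le
  have hD1 : (1 : ℝ) ≤ D := by exact_mod_cast Nat.one_le_iff_ne_zero.mpr hDne
  have hMbound : ∀ y ∈ Set.Icc ((D : ℝ) ^ 4) (bigP D ^ 2), y ^ z.re ≤ M := by
    intro y hy
    have hy1 : 1 ≤ y := le_trans (one_le_pow₀ hD1) hy.1
    rcases le_or_gt z.re 0 with hre | hre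
    · exact le_trans (Real.rpow_le_one_of_one_le_of_nonpos hy1 hre) hM1
    · calc y ^ z.re ≤ (bigP D ^ 2) ^ z.re := Real.rpow_le_rpow (by linarith) hy.2 hre.le
        _ = bigP D ^ (2 * z.re) := by
            rw [← Real.rpow_natCast, ← Real.rpow_mul hP.le]; norm_num
        _ ≤ bigP D ^ (2 * s.re - 1) :=
            Real.rpow_le_rpow_of_exponent_le hP1 (by rw [hzre]; linarith)
        _ ≤ M := le_mul_of_one_le_left (Real.rpow_pos_of_pos hP _).le
            (Real.one_le_exp (by positivity))
  -- `|z| ≤ 2𝓛₁`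
  have hznorm : ‖z‖ ≤ 2 * ell1 D := by
    have h1 : ‖z‖ ≤ |z.re| + |z.im| := Complex.norm_le_abs_re_add_abs_im z
    have h2 : |z.re| ≤ 1 := by
      rw [hzre, abs_le]; constructor <;> linarith
    have h3 : |z.im| ≤ ell1 D + 3 + ell D ^ 20 := by
      rw [hzim]
      have e : 2 * Real.pi * t0 D - s.im - v = -((s.im - 2 * Real.pi * t0 D) + v) := by ring
      rw [e, abs_neg]
      exact le_trans (abs_add_le _ _) (by linarith [ht.le])
    have h4 : ell D ^ 20 + 4 ≤ ell1 D := by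
      rw [ell1]
      have h20 : 4 ≤ ell D ^ 20 := by
        have h2 : ell D ^ 2 ≤ ell D ^ 20 := pow_le_pow_right₀ hℓ1 (by norm_num)
        nlinarith
      have h405 : ell D ^ 20 * ell D ^ 385 = ell D ^ 405 := by rw [← pow_add]
      have h385 : 2 ≤ ell D ^ 385 := le_trans hℓ2 (le_self_pow₀ hℓ1 (by norm_num))
      nlinarith [mul_le_mul h20 h385 (by norm_num) (by positivity), h405]
    linarith
  -- apply the tree's partial-integration bound
  have hPI := Lemma41.norm_sum_mul_cpow_le c ha0 hD4P2 z hMbound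
  rw [← hsum] at hPI
  have hX : ∀ y : ℝ, Lemma41.Xsum c ((D : ℝ) ^ 4) y = X3 χ x y := fun y => by
    rw [hc]; exact Xsum_eq_X3 χ x y
  simp_rw [hX] at hPI
  set B : ℝ := ‖X3 χ x (bigP D ^ 2)‖ + ∫ y in (D : ℝ) ^ 4..bigP D ^ 2, ‖X3 χ x y‖ / y with hB
  have hint : 0 ≤ ∫ y in (D : ℝ) ^ 4..bigP D ^ 2, ‖X3 χ x y‖ / y := by
    refine intervalIntegral.integral_nonneg hD4P2 fun y hy => ?_
    exact div_nonneg (norm_nonneg _) (le_trans (by positivity) hy.1)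
  have hM0 : 0 ≤ M := le_trans zero_le_one hM1
  have hℓ1ge : 1 ≤ ell1 D := by rw [ell1]; exact one_le_pow₀ hℓ1
  calc ‖∑ n ∈ Finset.Ioc (D ^ 4) ⌊bigP D ^ 2⌋₊,
          nu χ n * x.ψ (n : ZMod x.p) * (n : ℂ) ^ (-(sStar D s + v * I))‖
      ≤ M * ‖X3 χ x (bigP D ^ 2)‖
          + ‖z‖ * M * ∫ y in (D : ℝ) ^ 4..bigP D ^ 2, ‖X3 χ x y‖ / y := hPI
    _ ≤ (2 * ell1 D) * M * ‖X3 χ x (bigP D ^ 2)‖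
          + (2 * ell1 D) * M * ∫ y in (D : ℝ) ^ 4..bigP D ^ 2, ‖X3 χ x y‖ / y := by
        gcongr
        · exact le_mul_of_one_le_left hM0 (by linarith)
    _ = 2 * Real.exp (2 * Real.pi) * bigP D ^ (2 * s.re - 1) * ell1 D * B := by
        rw [hB, hM]; ring

end Literature.NumberTheory.LFunctions.Zhang2022.Section4

end
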